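import Literature.Analysis.FluidPDE.PassiveVectorModeEnergy
import Literature.Analysis.FluidPDE.LerayHopfCrossIdentityTorus
import Literature.Analysis.FunctionSpaces.TorusLinearisedFormTruncation
import Literature.Analysis.FunctionSpaces.TorusFourierCalculus
import HarnessLib

/-!
# Weak passive-vector solutions: the Galerkin energy identity at truncation level `N`

Analysis/FluidPDE proof-support file (everything proved; no new definitions). For the weak class
`Torus.IsWeakPassiveVectorOn A T ν b w₀ w` (`∂ₜw + (b·∇)w + A (w·∇)b + ∇π = νΔw`, `∇·w = 0`;
Yoshida–Kaneda 2000, (4)–(5)) we run the Fourier–Galerkin energy argument ON THE WEAK SOLUTION ITSELF,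
testing the time-sliced weak formulation against the truncations `P_N w(s) = Torus.fourierTruncate N (w s)`,
as the tree does for Leray–Hopf solutions (`DuchonRobertLionsEnergyEquality`, Serrin 1963 §4, along the
divergence-free frame `Torus.frameField`) and for scalars (`PassiveScalarDiagGalerkinIdentity`, RRS 2016 §4):
* slice tools: `⟪v,(u·∇)Ψ⟫ = ∑ⱼ ⟪uⱼ v, ∂ⱼΨ⟫`, integrability of the transport pairing when the products
  `uⱼ v` are integrable, linearity of the passive flux `Ψ ↦ ∫⟪v,(u·∇)Ψ + νΔΨ⟫ + A∫⟪u,(v·∇)Ψ⟫` over finite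
  real combinations (`sum_mul_passiveFlux_eq`);
* **the truncated energy identity** (`IsWeakPassiveVectorOn.ae_galerkin_energy_eq`): for an `L²` weakly
  divergence-free datum, every `N` and a.e. `t ∈ (0,T)`,
  `‖P_N w(t)‖² = ‖P_N w₀‖² + 2∫_{(0,t]} Φ[w; P_N w(s)](s) ds`, `Φ[w;Ψ](s) = ∫⟪w(s),(b(s)·∇)Ψ + νΔΨ⟫ + A∫⟪b(s),(w(s)·∇)Ψ⟫`,
  the integrand integrable on `(0,T)` (`integrableOn_galerkinFlux`) — the one-mode identities
  `PassiveVectorModeEnergy.ae_mode_energy_eq` summed over the frame, re-summed with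
  `fourierTruncate_eq_sum_integral_inner_smul_frameField`;
* slice-level rewriting of the flux against the own truncation: Stokes term `-ν‖∇P_N v‖₂²`, transport term
  `∫⟪v,(u·∇)P_N v⟫ = ∫⟪v - P_N v,(u·∇)P_N v⟫` for weakly divergence-free `u` (RRS 2016, (4.20)), and the
  bound `|∫⟪v,(u·∇)Ψ⟫| ≤ d·M·‖v‖₂‖∇Ψ‖₂` for `‖u‖ ≤ M`.
The limit `N → ∞` is taken in `PassiveVectorEnergyEquality`; consumer: route
`SolenoidalFractalHomogenisation`, support item `CascadeBookkeeping` (cell `ad-ideate`, LIT-PACK §40b).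

## Mathlib / tree search

Tree: `PassiveVectorModeEnergy`, `PassiveVectorFourier` (`ae_integrable_slice`), `LerayHopfCrossIdentityTorus` (frame),
`NSHopfGalerkinLimit` (`convect/laplacian_finset_sum_smul`), `StatisticalSolutionEnergyEq`
(`integral_inner_laplacian_fourierTruncate`), `NSUniqueness2DProofs` (`integral_inner_self_convect_eq_zero_of_isWeaklyDivFree`),
`TorusLinearisedFormTruncation` (Cauchy–Schwarz), `TorusFourierCalculus`. `lean search 'galerkin.*PassiveVector'`: nothing.

## References
* J. C. Robinson, J. L. Rodrigo, W. Sadowski, *The three-dimensional Navier–Stokes equations* (CUP 2016), §4.1–§4.2,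
  (4.20) [`RobinsonRodrigoSadowski2016`]; J. Serrin, in *Nonlinear Problems* (1963), §4 [`Serrin1963`];
  R. Temam, *Navier–Stokes Equations* (1984), Ch. III §1.1 [`Temam1984`]; L. Grafakos, GTM 249 (2014), Prop. 3.2.6 [`Grafakos2014`].
-/

noncomputable section

open MeasureTheory Set Filter Function TopologicalSpace
open scoped ENNReal NNReal InnerProductSpace

namespace Literature.Analysis.FluidPDE

namespace Torus

variable {d : Type*} [Fintype d] [DecidableEq d]

/-! ## Slice tools -/

section Slice

/-- `⟪v, (u·∇)Ψ⟫(x) = ∑ⱼ ⟪uⱼ(x) v(x), ∂ⱼΨ(x)⟫` for a `C¹` field `Ψ` (the trilinear form written in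
coordinates, Temam 1984, Ch. III §1.1). [cite: Temam1984, Ch. III §1.1] -/
theorem inner_convect_eq_sum_inner_smul {Ψ : UnitAddTorus d → EuclideanSpace ℝ d}
    (hΨ : FunctionSpaces.Torus.IsContDiff 1 Ψ) (u v : UnitAddTorus d → EuclideanSpace ℝ d) (x : UnitAddTorus d) :
    ⟪v x, FunctionSpaces.Torus.convect u Ψ x⟫_ℝ = ∑ j, ⟪u x j • v x, FunctionSpaces.Torus.partialDeriv j Ψ x⟫_ℝ := by
  rw [show FunctionSpaces.Torus.convect u Ψ x = FunctionSpaces.Torus.fderiv Ψ x (u x) from rfl,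
    IsWeakPassiveVectorOn.inner_convect_eq_sum' hΨ]
  refine Finset.sum_congr rfl fun j _ => ?_
  rw [real_inner_smul_left]

/-- The transport pairing `x ↦ ⟪v, (u·∇)Ψ⟫` is integrable as soon as the products `uⱼ v` are and
`Ψ` is smooth. [cite: Temam1984, Ch. III §1.1] -/
theorem integrable_inner_convect_of_integrable_smul {u v : UnitAddTorus d → EuclideanSpace ℝ d}
    (huv : ∀ j, Integrable (fun x => u x j • v x) volume) {Ψ : UnitAddTorus d → EuclideanSpace ℝ d}
    (hΨ : FunctionSpaces.Torus.IsSmooth Ψ) :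
    Integrable (fun x => ⟪v x, FunctionSpaces.Torus.convect u Ψ x⟫_ℝ) volume := by
  rw [show (fun x => ⟪v x, FunctionSpaces.Torus.convect u Ψ x⟫_ℝ) =
      fun x => ∑ j, ⟪u x j • v x, FunctionSpaces.Torus.partialDeriv j Ψ x⟫_ℝ from
    funext fun x => inner_convect_eq_sum_inner_smul (hΨ.isContDiff (by simp)) u v x]
  exact integrable_finsetSum _ fun j _ =>
    FunctionSpaces.Torus.integrable_inner_of_continuous (huv j) (hΨ.partialDeriv j).continuous

/-- Linearity of the transport pairing in the test field over finite real combinations: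
`∑ᵢ cᵢ ∫⟪v,(u·∇)aᵢ⟫ = ∫⟪v,(u·∇)(∑ᵢ cᵢ aᵢ)⟫`. [cite: RobinsonRodrigoSadowski2016, §4.1 (Galerkin truncations)] -/
theorem sum_mul_integral_inner_convect_eq {ι : Type*} (I : Finset ι) (c : ι → ℝ)
    {a : ι → UnitAddTorus d → EuclideanSpace ℝ d} (ha : ∀ i, FunctionSpaces.Torus.IsSmooth (a i))
    {u v : UnitAddTorus d → EuclideanSpace ℝ d} (huv : ∀ j, Integrable (fun x => u x j • v x) volume) :
    ∑ i ∈ I, c i * ∫ x, ⟪v x, FunctionSpaces.Torus.convect u (a i) x⟫_ℝ =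
      ∫ x, ⟪v x, FunctionSpaces.Torus.convect u (fun y => ∑ i ∈ I, c i • a i y) x⟫_ℝ := by
  simp_rw [← integral_const_mul]
  rw [← integral_finsetSum I fun i _ => (integrable_inner_convect_of_integrable_smul huv (ha i)).const_mul _]
  refine integral_congr_ae (ae_of_all _ fun x => ?_)
  dsimp only
  rw [convect_finset_sum_smul I c ha]
  simp only [inner_sum, inner_smul_right]

/-- Linearity of the viscous pairing in the test field over finite real combinations:
`∑ᵢ cᵢ ∫⟪v, Δaᵢ⟫ = ∫⟪v, Δ(∑ᵢ cᵢ aᵢ)⟫`. [cite: RobinsonRodrigoSadowski2016, §4.1 (Galerkin truncations)] -/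
theorem sum_mul_integral_inner_laplacian_eq {ι : Type*} (I : Finset ι) (c : ι → ℝ)
    {a : ι → UnitAddTorus d → EuclideanSpace ℝ d} (ha : ∀ i, FunctionSpaces.Torus.IsSmooth (a i))
    {v : UnitAddTorus d → EuclideanSpace ℝ d} (hv : Integrable v volume) :
    ∑ i ∈ I, c i * ∫ x, ⟪v x, FunctionSpaces.Torus.laplacian (a i) x⟫_ℝ =
      ∫ x, ⟪v x, FunctionSpaces.Torus.laplacian (fun y => ∑ i ∈ I, c i • a i y) x⟫_ℝ := by
  simp_rw [← integral_const_mul]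
  rw [← integral_finsetSum I fun i _ =>
    (FunctionSpaces.Torus.integrable_inner_of_continuous hv (ha i).laplacian.continuous).const_mul _]
  refine integral_congr_ae (ae_of_all _ fun x => ?_)
  dsimp only
  rw [laplacian_finset_sum_smul I c ha]
  simp only [inner_sum, inner_smul_right]

/-- The passive flux `∫⟪v, (u·∇)Ψ + νΔΨ⟫` splits into its transport and viscous parts.
[cite: RobinsonRodrigoSadowski2016, §4.1 (Galerkin truncations)] -/
theorem integral_inner_convect_add_smul_laplacian {u v : UnitAddTorus d → EuclideanSpace ℝ d}
    (hv : Integrable v volume) (huv : ∀ j, Integrable (fun x => u x j • v x) volume)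
    {Ψ : UnitAddTorus d → EuclideanSpace ℝ d} (hΨ : FunctionSpaces.Torus.IsSmooth Ψ) (ν : ℝ) :
    ∫ x, ⟪v x, FunctionSpaces.Torus.convect u Ψ x + ν • FunctionSpaces.Torus.laplacian Ψ x⟫_ℝ =
      (∫ x, ⟪v x, FunctionSpaces.Torus.convect u Ψ x⟫_ℝ) + ν * ∫ x, ⟪v x, FunctionSpaces.Torus.laplacian Ψ x⟫_ℝ := by
  have i1 := integrable_inner_convect_of_integrable_smul huv hΨ
  have i2 := FunctionSpaces.Torus.integrable_inner_of_continuous hv hΨ.laplacian.continuous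
  simp_rw [inner_add_right, real_inner_smul_right]
  rw [integral_add i1 (i2.const_mul ν), integral_const_mul]

/-- **Linearity of the passive flux in the test field**: for smooth `aᵢ`, reals `cᵢ` and
`Ψ = ∑ᵢ cᵢ aᵢ`,
`∑ᵢ cᵢ (∫⟪v,(u·∇)aᵢ + νΔaᵢ⟫ + A ∫⟪u,(v·∇)aᵢ⟫) = ∫⟪v,(u·∇)Ψ + νΔΨ⟫ + A ∫⟪u,(v·∇)Ψ⟫`
(`v` integrable, products `uⱼ v`, `vⱼ u` integrable). [cite: RobinsonRodrigoSadowski2016, §4.1 (Galerkin truncations)] -/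
theorem sum_mul_passiveFlux_eq {ι : Type*} (I : Finset ι) (c : ι → ℝ)
    {a : ι → UnitAddTorus d → EuclideanSpace ℝ d} (ha : ∀ i, FunctionSpaces.Torus.IsSmooth (a i)) (ν A : ℝ)
    {u v : UnitAddTorus d → EuclideanSpace ℝ d} (hv : Integrable v volume)
    (huv : ∀ j, Integrable (fun x => u x j • v x) volume) (hvu : ∀ j, Integrable (fun x => v x j • u x) volume) :
    ∑ i ∈ I, c i * ((∫ x, ⟪v x, FunctionSpaces.Torus.convect u (a i) x + ν • FunctionSpaces.Torus.laplacian (a i) x⟫_ℝ) +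
        A * ∫ x, ⟪u x, FunctionSpaces.Torus.convect v (a i) x⟫_ℝ) =
      (∫ x, ⟪v x, FunctionSpaces.Torus.convect u (fun y => ∑ i ∈ I, c i • a i y) x +
          ν • FunctionSpaces.Torus.laplacian (fun y => ∑ i ∈ I, c i • a i y) x⟫_ℝ) +
        A * ∫ x, ⟪u x, FunctionSpaces.Torus.convect v (fun y => ∑ i ∈ I, c i • a i y) x⟫_ℝ := by
  have hΨ : FunctionSpaces.Torus.IsSmooth (fun y => ∑ i ∈ I, c i • a i y) := isSmooth_finset_sum_smul I c ha
  rw [integral_inner_convect_add_smul_laplacian hv huv hΨ, ← sum_mul_integral_inner_convect_eq I c ha huv,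
    ← sum_mul_integral_inner_laplacian_eq I c ha hv, ← sum_mul_integral_inner_convect_eq I c ha hvu]
  simp_rw [integral_inner_convect_add_smul_laplacian hv huv (ha _)]
  rw [Finset.mul_sum, Finset.mul_sum, ← Finset.sum_add_distrib, ← Finset.sum_add_distrib]
  refine Finset.sum_congr rfl fun i _ => ?_
  ring

end Slice

/-! ## The truncated energy identity -/

section LevelN

namespace IsWeakPassiveVectorOn

variable {A T ν : ℝ} {b w : ℝ → UnitAddTorus d → EuclideanSpace ℝ d} {w₀ : UnitAddTorus d → EuclideanSpace ℝ d}

/-- **The flux against the own truncations is integrable in time**: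
`s ↦ Φ[w; P_N w(s)](s) = ∫⟪w(s), (b(s)·∇)P_N w(s) + νΔP_N w(s)⟫ + A ∫⟪b(s), (w(s)·∇)P_N w(s)⟫` is
integrable on `(0,T)` (along the frame it is `∑ᵢ ⟪w(s), gᵢ⟫ · Φ[w; gᵢ](s)`, essentially bounded
coefficients times integrable fluxes; twin of
`IsLerayHopfOn.integrableOn_flux_fourierTruncate_L1L2`). [cite: Serrin1963, §4 (proof of Thm. 6)] -/
theorem integrableOn_galerkinFlux (h : IsWeakPassiveVectorOn A T ν b w₀ w) (N : ℕ) :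
    IntegrableOn (fun s =>
      (∫ x, ⟪w s x, FunctionSpaces.Torus.convect (b s) (FunctionSpaces.Torus.fourierTruncate N (w s)) x +
          ν • FunctionSpaces.Torus.laplacian (FunctionSpaces.Torus.fourierTruncate N (w s)) x⟫_ℝ) +
        A * ∫ x, ⟪b s x, FunctionSpaces.Torus.convect (w s) (FunctionSpaces.Torus.fourierTruncate N (w s)) x⟫_ℝ)
      (Ioo 0 T) := by
  classical
  set I : Finset ((d → ℤ) × d × Bool) :=
    FunctionSpaces.Torus.freqBall N ×ˢ ((Finset.univ : Finset d) ×ˢ (Finset.univ : Finset Bool)) with hI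
  set a : (d → ℤ) × d × Bool → UnitAddTorus d → EuclideanSpace ℝ d := fun i => frameField i.1 i.2.1 i.2.2 with ha
  have ha_smooth : ∀ i, FunctionSpaces.Torus.IsSmooth (a i) := fun i => isSmooth_frameField _ _ _
  have ha_cont : ∀ i, Continuous (a i) := fun i => continuous_frameField _ _ _
  -- the frame expansion, for a.e. `s`
  have hIdent : ∀ᵐ s ∂(volume.restrict (Ioo 0 T)),
      ∑ i ∈ I, (∫ x, ⟪w s x, a i x⟫_ℝ) *
          ((∫ x, ⟪w s x, FunctionSpaces.Torus.convect (b s) (a i) x + ν • FunctionSpaces.Torus.laplacian (a i) x⟫_ℝ) +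
            A * ∫ x, ⟪b s x, FunctionSpaces.Torus.convect (w s) (a i) x⟫_ℝ) =
        (∫ x, ⟪w s x, FunctionSpaces.Torus.convect (b s) (FunctionSpaces.Torus.fourierTruncate N (w s)) x +
            ν • FunctionSpaces.Torus.laplacian (FunctionSpaces.Torus.fourierTruncate N (w s)) x⟫_ℝ) +
          A * ∫ x, ⟪b s x, FunctionSpaces.Torus.convect (w s) (FunctionSpaces.Torus.fourierTruncate N (w s)) x⟫_ℝ := by
    filter_upwards [h.ae_integrable_slice, h.ae_memLp_two, h.ae_isWeaklyDivFree] with s hs hs2 hsdiv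
    rw [sum_mul_passiveFlux_eq I (fun i => ∫ x, ⟪w s x, a i x⟫_ℝ) ha_smooth ν A hs.1 hs.2.1 hs.2.2,
      fourierTruncate_eq_sum_integral_inner_smul_frameField hs2 hsdiv N]
  -- integrability of the expansion
  have hsum : IntegrableOn (fun s => ∑ i ∈ I, (∫ x, ⟪w s x, a i x⟫_ℝ) *
      ((∫ x, ⟪w s x, FunctionSpaces.Torus.convect (b s) (a i) x + ν • FunctionSpaces.Torus.laplacian (a i) x⟫_ℝ) +
        A * ∫ x, ⟪b s x, FunctionSpaces.Torus.convect (w s) (a i) x⟫_ℝ)) (Ioo 0 T) := by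
    refine integrable_finsetSum I fun i _ => ?_
    obtain ⟨C, hC⟩ := h.exists_ae_abs_integral_inner_le (ha_cont i)
    have hac : Continuous (uncurry fun (_ : ℝ) (x : UnitAddTorus d) => a i x) := (ha_cont i).comp continuous_snd
    have hm : AEStronglyMeasurable (fun s => ∫ x, ⟪w s x, a i x⟫_ℝ) (volume.restrict (Ioo 0 T)) :=
      (h.integrable_inner_of_continuous hac).integral_prod_left.aestronglyMeasurable
    exact (h.integrableOn_steadyRHS (ha_smooth i)).bdd_mul hm (hC.mono fun s hs => by rwa [Real.norm_eq_abs])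
  exact hsum.congr hIdent

/-- **The Galerkin energy identity of a weak passive-vector solution at truncation level `N`.**
For a weak solution `w ∈ L^∞_t L²_x` of `∂ₜw + (b·∇)w + A (w·∇)b + ∇π = νΔw`, `∇·w = 0` on
`T^d × [0,T)` with an `L²` weakly divergence-free datum `w₀`, every `N` and a.e. `t ∈ (0,T)`:
`∫⟪P_N w(t), P_N w(t)⟫ = ∫⟪P_N w₀, P_N w₀⟫ + 2 ∫_{(0,t]} Φ[w; P_N w(s)](s) ds`,
`Φ[w; Ψ](s) = ∫⟪w(s), (b(s)·∇)Ψ + νΔΨ⟫ + A ∫⟪b(s), (w(s)·∇)Ψ⟫` — the Galerkin system tested against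
its own solution (Robinson–Rodrigo–Sadowski 2016, §4.2 (4.20)), obtained by summing the one-mode
identities `ae_mode_energy_eq` over the divergence-free frame `g_{kjc}`, `|k| ≤ N`, and re-summing the
fluxes with the frame expansion `P_N w(s) = ∑ᵢ ⟪w(s), gᵢ⟫ gᵢ` (valid because `w(s)` is weakly
divergence free for a.e. `s`). [cite: RobinsonRodrigoSadowski2016, §4.2 (4.20)] -/
theorem ae_galerkin_energy_eq (h : IsWeakPassiveVectorOn A T ν b w₀ w) (hw₀ : MemLp w₀ 2 volume)
    (hdiv₀ : FunctionSpaces.Torus.IsWeaklyDivFree w₀) (N : ℕ) :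
    ∀ᵐ t ∂(volume.restrict (Ioo 0 T)),
      ∫ x, ⟪FunctionSpaces.Torus.fourierTruncate N (w t) x, FunctionSpaces.Torus.fourierTruncate N (w t) x⟫_ℝ =
        (∫ x, ⟪FunctionSpaces.Torus.fourierTruncate N w₀ x, FunctionSpaces.Torus.fourierTruncate N w₀ x⟫_ℝ) +
          2 * ∫ s in Ioc 0 t,
            ((∫ x, ⟪w s x, FunctionSpaces.Torus.convect (b s) (FunctionSpaces.Torus.fourierTruncate N (w s)) x +
                ν • FunctionSpaces.Torus.laplacian (FunctionSpaces.Torus.fourierTruncate N (w s)) x⟫_ℝ) +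
              A * ∫ x, ⟪b s x, FunctionSpaces.Torus.convect (w s) (FunctionSpaces.Torus.fourierTruncate N (w s)) x⟫_ℝ) := by
  classical
  -- ### the frame
  set I : Finset ((d → ℤ) × d × Bool) :=
    FunctionSpaces.Torus.freqBall N ×ˢ ((Finset.univ : Finset d) ×ˢ (Finset.univ : Finset Bool)) with hI
  set a : (d → ℤ) × d × Bool → UnitAddTorus d → EuclideanSpace ℝ d := fun i => frameField i.1 i.2.1 i.2.2 with ha
  have ha_smooth : ∀ i, FunctionSpaces.Torus.IsSmooth (a i) := fun i => isSmooth_frameField _ _ _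
  have ha_div : ∀ i, FunctionSpaces.Torus.IsDivFree (a i) := fun i => isDivFree_frameField' _ _ _
  have ha_cont : ∀ i, Continuous (a i) := fun i => continuous_frameField _ _ _
  -- ### coefficient functions and their fluxes
  set Acoef : (d → ℤ) × d × Bool → ℝ → ℝ := fun i s => ∫ x, ⟪w s x, a i x⟫_ℝ with hA
  set φ : (d → ℤ) × d × Bool → ℝ → ℝ := fun i s =>
    (∫ x, ⟪w s x, FunctionSpaces.Torus.convect (b s) (a i) x + ν • FunctionSpaces.Torus.laplacian (a i) x⟫_ℝ) +
      A * ∫ x, ⟪b s x, FunctionSpaces.Torus.convect (w s) (a i) x⟫_ℝ with hφ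
  have hφint : ∀ i, IntegrableOn (φ i) (Ioo 0 T) := fun i => h.integrableOn_steadyRHS (ha_smooth i)
  -- ### the one-mode identities, for a.e. `t` and every `i`
  have hmode : ∀ᵐ t ∂(volume.restrict (Ioo 0 T)), ∀ i,
      (Acoef i t) ^ 2 = (∫ x, ⟪w₀ x, a i x⟫_ℝ) ^ 2 + 2 * ∫ τ in Ioc 0 t, φ i τ * Acoef i τ :=
    ae_all_iff.2 fun i => h.ae_mode_energy_eq (ha_smooth i) (ha_div i)
  -- ### integrability of `φᵢ · Aᵢ` on `(0,T)`
  have hφA : ∀ i, IntegrableOn (fun s => φ i s * Acoef i s) (Ioo 0 T) := by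
    intro i
    obtain ⟨C, hC⟩ := h.exists_ae_abs_integral_inner_le (ha_cont i)
    have hac : Continuous (uncurry fun (_ : ℝ) (x : UnitAddTorus d) => a i x) := (ha_cont i).comp continuous_snd
    have hm : AEStronglyMeasurable (fun s => ∫ x, ⟪w s x, a i x⟫_ℝ) (volume.restrict (Ioo 0 T)) :=
      (h.integrable_inner_of_continuous hac).integral_prod_left.aestronglyMeasurable
    exact (hφint i).mul_bdd hm (hC.mono fun s hs => by rwa [Real.norm_eq_abs])
  -- ### identification of the summed integrand, for a.e. `s`
  have hIdent : ∀ᵐ s ∂(volume.restrict (Ioo 0 T)), ∑ i ∈ I, φ i s * Acoef i s =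
      (∫ x, ⟪w s x, FunctionSpaces.Torus.convect (b s) (FunctionSpaces.Torus.fourierTruncate N (w s)) x +
          ν • FunctionSpaces.Torus.laplacian (FunctionSpaces.Torus.fourierTruncate N (w s)) x⟫_ℝ) +
        A * ∫ x, ⟪b s x, FunctionSpaces.Torus.convect (w s) (FunctionSpaces.Torus.fourierTruncate N (w s)) x⟫_ℝ := by
    filter_upwards [h.ae_integrable_slice, h.ae_memLp_two, h.ae_isWeaklyDivFree] with s hs hs2 hsdiv
    calc ∑ i ∈ I, φ i s * Acoef i s = ∑ i ∈ I, Acoef i s * φ i s := Finset.sum_congr rfl fun i _ => mul_comm _ _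
      _ = _ := sum_mul_passiveFlux_eq I (fun i => Acoef i s) ha_smooth ν A hs.1 hs.2.1 hs.2.2
      _ = _ := by rw [fourierTruncate_eq_sum_integral_inner_smul_frameField hs2 hsdiv N]
  have hIdent' : ∀ᵐ s ∂(volume : Measure ℝ), s ∈ Ioo 0 T → ∑ i ∈ I, φ i s * Acoef i s =
      (∫ x, ⟪w s x, FunctionSpaces.Torus.convect (b s) (FunctionSpaces.Torus.fourierTruncate N (w s)) x +
          ν • FunctionSpaces.Torus.laplacian (FunctionSpaces.Torus.fourierTruncate N (w s)) x⟫_ℝ) +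
        A * ∫ x, ⟪b s x, FunctionSpaces.Torus.convect (w s) (FunctionSpaces.Torus.fourierTruncate N (w s)) x⟫_ℝ :=
    (ae_restrict_iff' measurableSet_Ioo).1 hIdent
  -- ### the datum side
  have h0 : ∫ x, ⟪FunctionSpaces.Torus.fourierTruncate N w₀ x, FunctionSpaces.Torus.fourierTruncate N w₀ x⟫_ℝ =
      ∑ i ∈ I, (∫ x, ⟪w₀ x, a i x⟫_ℝ) * ∫ x, ⟪w₀ x, a i x⟫_ℝ :=
    integral_inner_fourierTruncate_fourierTruncate_eq_sum hw₀ hw₀ hdiv₀ N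
  -- ### assemble at a.e. `t`
  filter_upwards [hmode, h.ae_memLp_two, h.ae_isWeaklyDivFree, ae_restrict_mem measurableSet_Ioo]
    with t ht ht2 htdiv htI
  have hsub : Ioc 0 t ⊆ Ioo 0 T := Ioc_subset_Ioo_right htI.2
  have hLHS : ∫ x, ⟪FunctionSpaces.Torus.fourierTruncate N (w t) x, FunctionSpaces.Torus.fourierTruncate N (w t) x⟫_ℝ =
      ∑ i ∈ I, Acoef i t * Acoef i t :=
    integral_inner_fourierTruncate_fourierTruncate_eq_sum ht2 ht2 htdiv N
  have hφAt : ∀ i, IntegrableOn (fun s => φ i s * Acoef i s) (Ioc 0 t) := fun i => (hφA i).mono_set hsub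
  rw [hLHS, h0]
  calc ∑ i ∈ I, Acoef i t * Acoef i t
      = ∑ i ∈ I, ((∫ x, ⟪w₀ x, a i x⟫_ℝ) * (∫ x, ⟪w₀ x, a i x⟫_ℝ) + 2 * ∫ τ in Ioc 0 t, φ i τ * Acoef i τ) := by
        refine Finset.sum_congr rfl fun i _ => ?_
        rw [← sq, ht i, sq]
    _ = (∑ i ∈ I, (∫ x, ⟪w₀ x, a i x⟫_ℝ) * ∫ x, ⟪w₀ x, a i x⟫_ℝ) +
          2 * ∫ τ in Ioc 0 t, ∑ i ∈ I, φ i τ * Acoef i τ := by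
        rw [Finset.sum_add_distrib, integral_finsetSum I fun i _ => hφAt i, Finset.mul_sum]
    _ = _ := by
        congr 1
        congr 1
        refine setIntegral_congr_ae measurableSet_Ioc ?_
        filter_upwards [hIdent'] with s hs hsI
        exact hs (hsub hsI)

end IsWeakPassiveVectorOn

end LevelN

/-! ## The flux against the own truncation: Stokes term, transport remainder, bound -/

section Split

/-- **The viscous term against the own truncation is the truncated dissipation**:
`∫⟪v, (u·∇)P_N v + νΔP_N v⟫ = ∫⟪v,(u·∇)P_N v⟫ - ν‖∇P_N v‖₂²`
(`∫⟪v, ΔP_N v⟫ = -‖∇P_N v‖₂²`, `integral_inner_laplacian_fourierTruncate`). [cite: RobinsonRodrigoSadowski2016, §4.2 (4.20)] -/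
theorem integral_inner_convect_add_smul_laplacian_fourierTruncate
    {u v : UnitAddTorus d → EuclideanSpace ℝ d} (hv : Integrable v volume)
    (huv : ∀ j, Integrable (fun x => u x j • v x) volume) (ν : ℝ) (N : ℕ) :
    ∫ x, ⟪v x, FunctionSpaces.Torus.convect u (FunctionSpaces.Torus.fourierTruncate N v) x +
        ν • FunctionSpaces.Torus.laplacian (FunctionSpaces.Torus.fourierTruncate N v) x⟫_ℝ =
      (∫ x, ⟪v x, FunctionSpaces.Torus.convect u (FunctionSpaces.Torus.fourierTruncate N v) x⟫_ℝ) -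
        ν * (FunctionSpaces.Torus.eGradNormSq (FunctionSpaces.Torus.fourierTruncate N v)).toReal := by
  rw [integral_inner_convect_add_smul_laplacian hv huv (FunctionSpaces.Torus.isSmooth_fourierTruncate N v) ν,
    integral_inner_laplacian_fourierTruncate hv N]
  ring

/-- **The transport pairing against the own truncation only sees the truncation remainder**: for a
weakly divergence-free `u`, `∫⟪v,(u·∇)P_N v⟫ = ∫⟪v - P_N v,(u·∇)P_N v⟫`
(`∫⟪P_N v,(u·∇)P_N v⟫ = ½∫⟪u, ∇|P_N v|²⟫ = 0`; Robinson–Rodrigo–Sadowski 2016, (4.20)).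
[cite: RobinsonRodrigoSadowski2016, §4.2 (4.20)] -/
theorem integral_inner_convect_fourierTruncate_eq_remainder
    {u v : UnitAddTorus d → EuclideanSpace ℝ d} (hu : Integrable u volume)
    (hudiv : FunctionSpaces.Torus.IsWeaklyDivFree u)
    (huv : ∀ j, Integrable (fun x => u x j • v x) volume) (N : ℕ) :
    ∫ x, ⟪v x, FunctionSpaces.Torus.convect u (FunctionSpaces.Torus.fourierTruncate N v) x⟫_ℝ =
      ∫ x, ⟪v x - FunctionSpaces.Torus.fourierTruncate N v x,
        FunctionSpaces.Torus.convect u (FunctionSpaces.Torus.fourierTruncate N v) x⟫_ℝ := by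
  have hs : FunctionSpaces.Torus.IsSmooth (FunctionSpaces.Torus.fourierTruncate N v) :=
    FunctionSpaces.Torus.isSmooth_fourierTruncate N v
  have i1 := integrable_inner_convect_of_integrable_smul huv hs
  have hPv : ∀ j, Integrable (fun x => u x j • FunctionSpaces.Torus.fourierTruncate N v x) volume := by
    intro j
    obtain ⟨C, hC⟩ := (isCompact_univ.image hs.continuous).isBounded.exists_norm_le
    have hC' : ∀ x, ‖FunctionSpaces.Torus.fourierTruncate N v x‖ ≤ C := fun x => hC _ ⟨x, mem_univ _, rfl⟩
    refine Integrable.mono' (hu.norm.mul_const C)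
      (((EuclideanSpace.proj j).continuous.comp_aestronglyMeasurable hu.1).smul hs.continuous.aestronglyMeasurable)
      (ae_of_all _ fun x => ?_)
    rw [norm_smul]
    exact mul_le_mul (by simpa [Real.norm_eq_abs] using FunctionSpaces.Torus.abs_apply_le_norm (u x) j) (hC' x)
      (norm_nonneg _) (norm_nonneg _)
  have i2 := integrable_inner_convect_of_integrable_smul hPv hs
  have h0 := integral_inner_self_convect_eq_zero_of_isWeaklyDivFree hudiv hs
  simp_rw [inner_sub_left]
  rw [integral_sub i1 i2, h0, sub_zero]

/-- **The transport pairing against a smooth field is controlled by the dissipation**: if `‖u‖ ≤ M`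
a.e. and `v ∈ L²`, then `|∫⟪v,(u·∇)Ψ⟫| ≤ d · M · (∫‖v‖²)^{1/2} · (gradNormSq Ψ)^{1/2}`
(`‖(u·∇)Ψ‖ ≤ ‖u‖ ∑ⱼ‖∂ⱼΨ‖`, Cauchy–Schwarz, `∫‖∂ⱼΨ‖² ≤ ∫∑ᵢ‖∂ᵢΨ‖²`). [cite: RobinsonRodrigoSadowski2016, §4.2 (energy estimate)] -/
theorem abs_integral_inner_convect_le_of_norm_le {u v : UnitAddTorus d → EuclideanSpace ℝ d}
    (hv : MemLp v 2 volume) {M : ℝ} (hM : 0 ≤ M)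
    (huM : ∀ᵐ x ∂volume, ‖u x‖ ≤ M)
    {Ψ : UnitAddTorus d → EuclideanSpace ℝ d} (hΨ : FunctionSpaces.Torus.IsSmooth Ψ) :
    |∫ x, ⟪v x, FunctionSpaces.Torus.convect u Ψ x⟫_ℝ| ≤
      Fintype.card d * M * Real.sqrt (∫ x, ‖v x‖ ^ 2) * Real.sqrt (FunctionSpaces.Torus.gradNormSq Ψ) := by
  have h1 : FunctionSpaces.Torus.IsContDiff 1 Ψ := hΨ.isContDiff (by simp)
  -- pointwise bound
  have hpt : ∀ᵐ x ∂volume, |⟪v x, FunctionSpaces.Torus.convect u Ψ x⟫_ℝ| ≤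
      M * ∑ j, ‖v x‖ * ‖FunctionSpaces.Torus.partialDeriv j Ψ x‖ := by
    filter_upwards [huM] with x hx
    calc |⟪v x, FunctionSpaces.Torus.convect u Ψ x⟫_ℝ| ≤ ‖v x‖ * ‖FunctionSpaces.Torus.convect u Ψ x‖ :=
          abs_real_inner_le_norm _ _
      _ ≤ ‖v x‖ * (‖u x‖ * ∑ j, ‖FunctionSpaces.Torus.partialDeriv j Ψ x‖) :=
          mul_le_mul_of_nonneg_left (FunctionSpaces.Torus.norm_convect_le u h1 x) (norm_nonneg _)
      _ ≤ ‖v x‖ * (M * ∑ j, ‖FunctionSpaces.Torus.partialDeriv j Ψ x‖) :=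
          mul_le_mul_of_nonneg_left (mul_le_mul_of_nonneg_right hx (Finset.sum_nonneg fun j _ => norm_nonneg _))
            (norm_nonneg _)
      _ = M * ∑ j, ‖v x‖ * ‖FunctionSpaces.Torus.partialDeriv j Ψ x‖ := by rw [Finset.mul_sum, Finset.mul_sum, Finset.mul_sum]; exact Finset.sum_congr rfl fun j _ => by ring
  have hint : ∀ j, Integrable (fun x => ‖v x‖ * ‖FunctionSpaces.Torus.partialDeriv j Ψ x‖) volume := by
    intro j
    obtain ⟨C, hC⟩ := (isCompact_univ.image (hΨ.partialDeriv j).continuous).isBounded.exists_norm_le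
    have hC' : ∀ x, ‖FunctionSpaces.Torus.partialDeriv j Ψ x‖ ≤ C := fun x => hC _ ⟨x, mem_univ _, rfl⟩
    exact ((hv.integrable one_le_two).norm.mul_const C).mono'
      (hv.1.norm.mul (hΨ.partialDeriv j).continuous.aestronglyMeasurable.norm)
      (ae_of_all _ fun x => by
        rw [Real.norm_eq_abs, abs_of_nonneg (mul_nonneg (norm_nonneg _) (norm_nonneg _))]
        exact mul_le_mul_of_nonneg_left (hC' x) (norm_nonneg _))
  have hgrad : ∀ j, ∫ x, ‖FunctionSpaces.Torus.partialDeriv j Ψ x‖ ^ 2 ≤ FunctionSpaces.Torus.gradNormSq Ψ := by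
    intro j
    unfold FunctionSpaces.Torus.gradNormSq
    refine integral_mono_of_nonneg (ae_of_all _ fun x => sq_nonneg _) ?_ (ae_of_all _ fun x => ?_)
    · exact (continuous_finsetSum _ fun i _ => ((hΨ.partialDeriv i).continuous.norm.pow 2)).integrable_of_hasCompactSupport
        (HasCompactSupport.of_compactSpace _)
    · exact Finset.single_le_sum (f := fun i => ‖FunctionSpaces.Torus.partialDeriv i Ψ x‖ ^ 2)
        (fun i _ => sq_nonneg _) (Finset.mem_univ j)
  calc |∫ x, ⟪v x, FunctionSpaces.Torus.convect u Ψ x⟫_ℝ|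
      ≤ ∫ x, |⟪v x, FunctionSpaces.Torus.convect u Ψ x⟫_ℝ| := abs_integral_le_integral_abs
    _ ≤ ∫ x, M * ∑ j, ‖v x‖ * ‖FunctionSpaces.Torus.partialDeriv j Ψ x‖ :=
        integral_mono_of_nonneg (ae_of_all _ fun x => abs_nonneg _)
          ((integrable_finsetSum _ fun j _ => hint j).const_mul M) hpt
    _ = M * ∑ j, ∫ x, ‖v x‖ * ‖FunctionSpaces.Torus.partialDeriv j Ψ x‖ := by
        rw [integral_const_mul, integral_finsetSum _ fun j _ => hint j]
    _ ≤ M * ∑ j : d, Real.sqrt (∫ x, ‖v x‖ ^ 2) * Real.sqrt (FunctionSpaces.Torus.gradNormSq Ψ) := by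
        refine mul_le_mul_of_nonneg_left (Finset.sum_le_sum fun j _ => ?_) hM
        calc ∫ x, ‖v x‖ * ‖FunctionSpaces.Torus.partialDeriv j Ψ x‖
            ≤ Real.sqrt (∫ x, ‖v x‖ ^ 2) * Real.sqrt (∫ x, ‖FunctionSpaces.Torus.partialDeriv j Ψ x‖ ^ 2) :=
              FunctionSpaces.Torus.integral_norm_mul_norm_le_sqrt_sq_mul_sqrt_sq hv
                ((hΨ.partialDeriv j).continuous.memLp_of_hasCompactSupport (HasCompactSupport.of_compactSpace _))
          _ ≤ Real.sqrt (∫ x, ‖v x‖ ^ 2) * Real.sqrt (FunctionSpaces.Torus.gradNormSq Ψ) :=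
              mul_le_mul_of_nonneg_left (Real.sqrt_le_sqrt (hgrad j)) (Real.sqrt_nonneg _)
    _ = Fintype.card d * M * Real.sqrt (∫ x, ‖v x‖ ^ 2) * Real.sqrt (FunctionSpaces.Torus.gradNormSq Ψ) := by
        rw [Finset.sum_const, Finset.card_univ, nsmul_eq_mul]
        ring

/-- The truncated dissipation in real form: `gradNormSq (P_N v) = (eGradNormSq (P_N v)).toReal`
(smooth truncations; `gradNormSq_eq_toReal_eGradNormSq_holds`). [cite: Grafakos2014, Prop. 3.2.6 (8)] -/
theorem gradNormSq_fourierTruncate (N : ℕ) (v : UnitAddTorus d → EuclideanSpace ℝ d) :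
    FunctionSpaces.Torus.gradNormSq (FunctionSpaces.Torus.fourierTruncate N v) =
      (FunctionSpaces.Torus.eGradNormSq (FunctionSpaces.Torus.fourierTruncate N v)).toReal :=
  FunctionSpaces.Torus.gradNormSq_eq_toReal_eGradNormSq_holds (FunctionSpaces.Torus.isSmooth_fourierTruncate N v)

end Split

end Torus

end Literature.Analysis.FluidPDE

end
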